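import Summits.AtomisticToContinuum.HydrodynamicLimit.Theses.RelayRaceLocality

/-!
# Sketch — crux-ideate r2 k5, crux `ConeLocalisation` (stmt-AtomisticToContinuum-12504)
Idea `einstein-elevator`: typed FIRST LEMMA (dynamic log-Lipschitz rigidity of the guard class) and the two
foreign stubs it isolates (`ScaleCovariantNearConstantHL` = B made hyperbolic-scaling covariant,
`NearAtmosphereHL` = B's fielded twin seen through the Galilean elevator). Props only; nothing asserted.
-/

noncomputable section

open Literature.MathematicalPhysics.KineticTheory Literature.Analysis.FluidPDE
open Literature.Analysis.FunctionSpaces MeasureTheory Filter Set Topology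
open Summit.AtomisticToContinuum.HydrodynamicLimit.Theses.RelayRaceLocality

namespace Summit.AtomisticToContinuum.HydrodynamicLimit.Cruxes.ConeLocalisation.EinsteinElevator

/-- The level-`M` guard conjunction of `S` (consequent of `ConeLocalisation`) at `(s, x)`, verbatim, with packing
threshold `η`. -/
@[folklore] def GuardAt (η M σ : ℝ) (ρ θ : ℝ → T3 → ℝ) (u : ℝ → T3 → V3) (s : ℝ) (x : T3) : Prop :=
  ρ s x * σ ^ 3 < η ∧ ρ s x ≤ M ∧ θ s x ≤ M ∧ M⁻¹ ≤ θ s x ∧ ‖u s x‖ ≤ M ∧ ∀ i j k : Fin 3,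
    |Torus.partialDeriv i (ρ s) x| ≤ M ∧ ‖Torus.partialDeriv i (u s) x‖ ≤ M ∧ |Torus.partialDeriv i (θ s) x| ≤ M ∧
    |Torus.partialDeriv i (Torus.partialDeriv j (ρ s)) x| ≤ M ∧ ‖Torus.partialDeriv i (Torus.partialDeriv j (u s)) x‖ ≤ M ∧
    |Torus.partialDeriv i (Torus.partialDeriv j (θ s)) x| ≤ M ∧
    |Torus.partialDeriv i (Torus.partialDeriv j (Torus.partialDeriv k (ρ s))) x| ≤ M ∧
    ‖Torus.partialDeriv i (Torus.partialDeriv j (Torus.partialDeriv k (u s))) x‖ ≤ M ∧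
    |Torus.partialDeriv i (Torus.partialDeriv j (Torus.partialDeriv k (θ s))) x| ≤ M

/-- **FIRST LEMMA — dynamic log-Lipschitz rigidity of the guard class.** There are a packing band `η₁`, a constant
`C` and an exponent `a` such that for every level `M ≥ 1`, every classical hs-Euler solution and every `0 < t < T`
with `t · C Mᵃ ≤ 1`: if the level-`M` guards of `S` hold on `[0, t] × 𝕋³`, then ALL relative log-density
derivatives of order `≤ 3` are bounded by `C Mᵃ / t` on `[0, t] × 𝕋³`. (Proof route: the specific entropy
`s = log(θ^{3/2}/ρ) −` virial correction is transported, `D_t s = 0`, so `∇ᵏ s` is quasi-constant along Lagrangian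
paths up to flow-map distortion `e^{O(Mt)}`; the momentum equation reads `D_t u = θκ ∇s − B(θ, ∇θ)` with
`κ = Z + ηZ' ∈ [½, 2]`, `|B| ≤ C M²`; `‖u‖ ≤ M` at both ends of the path forces `t θ κ |∇s| ≤ 2M + C M² t`; the
same with `∇u`, `∇²u` at both ends bounds `∇²s`, `∇³s`; `∇ᵏ log ρ = (3/2)∇ᵏ log θ − ∇ᵏ s +` virial terms.) -/
@[conjecture] def DynamicLogLipschitz : Prop :=
  ∃ η₁ : ℝ, 0 < η₁ ∧ ∃ C : ℝ, 0 < C ∧ ∃ a : ℕ, ∀ M : ℝ, 1 ≤ M →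
    ∀ (σ T : ℝ) (ρ θ : ℝ → T3 → ℝ) (u : ℝ → T3 → V3), 0 < σ → σ ≤ 1 → IsHardSphereEulerSolution σ T ρ u θ →
    ∀ t : ℝ, 0 < t → t < T → t * (C * M ^ a) ≤ 1 →
    (∀ s ∈ Set.Icc 0 t, ∀ x, GuardAt η₁ M σ ρ θ u s x) →
    ∀ s ∈ Set.Icc 0 t, ∀ x, ∀ i j k : Fin 3,
      |Torus.partialDeriv i (fun y => Real.log (ρ s y)) x| ≤ C * M ^ a / t ∧
      |Torus.partialDeriv i (Torus.partialDeriv j (fun y => Real.log (ρ s y))) x| ≤ C * M ^ a / t ∧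
      |Torus.partialDeriv i (Torus.partialDeriv j (Torus.partialDeriv k (fun y => Real.log (ρ s y)))) x| ≤ C * M ^ a / t

/-- **Corollary — dynamic density floor.** Under the same hypotheses and unit mass, the guards being alive on
`[0, t]` FORCE the floor `ρ ≥ exp (−C Mᵃ / t)` on `[0, t] × 𝕋³` (log-Lipschitz bound × diameter of `𝕋³`, and
`max ρ(s, ·) ≥ 1` by mass conservation). The guard class of `S` at level `M` over `[0, t]` is never deeper than
`e^{-CMᵃ/t}`: the only floor-free content of `S` sits at `t ↓ 0`. -/
@[conjecture] def DynamicFloor : Prop :=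
  ∃ η₁ : ℝ, 0 < η₁ ∧ ∃ C : ℝ, 0 < C ∧ ∃ a : ℕ, ∀ M : ℝ, 1 ≤ M →
    ∀ (σ T : ℝ) (ρ θ : ℝ → T3 → ℝ) (u : ℝ → T3 → V3), 0 < σ → σ ≤ 1 → IsHardSphereEulerSolution σ T ρ u θ →
    (∫ x, ρ 0 x) = 1 →
    ∀ t : ℝ, 0 < t → t < T → t * (C * M ^ a) ≤ 1 →
    (∀ s ∈ Set.Icc 0 t, ∀ x, GuardAt η₁ M σ ρ θ u s x) →
    ∀ s ∈ Set.Icc 0 t, ∀ x, Real.exp (-(C * M ^ a / t)) ≤ ρ s x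

/-- **Foreign stub 1 — `B` made hyperbolic-scaling covariant** (`ScaleCovariantNearConstantHL`): verbatim
`NearConstantShortTimeHL` except that the horizon is `s₀(M) / L` for data whose FIRST derivatives are bounded by an
arbitrary level `L ≥ M` on `[0, t]` (the other guards stay at level `M`). With `L = M` it is `B` with `τ₀ = s₀/M`.
It is what the cone-flat but `C¹`-rough low-density points of the unfloored `S` need. -/
@[conjecture] def ScaleCovariantNearConstantHL : Prop :=
  ∃ η₀ : ℝ, 0 < η₀ ∧ ∀ M : ℝ, 0 < M → ∃ δ₀ : ℝ, 0 < δ₀ ∧ ∃ s₀ : ℝ, 0 < s₀ ∧ ∀ (a₀ θ₀ : T3 → ℝ) (u₀ : T3 → V3), Continuous a₀ → Continuous θ₀ → Continuous u₀ → (∀ x, 0 < a₀ x) → (∀ x, 0 < θ₀ x) → ∃ σ₀ : ℝ, 0 < σ₀ ∧ ∀ σ : ℝ, 0 < σ → σ < σ₀ → ∀ (ε : ℕ → ℝ) (n : ℕ → ℕ), (∀ N, 0 < ε N) → Tendsto ε atTop (nhds 0) → Tendsto (fun N => (n N : ℝ) * ε N ^ 3) atTop (nhds (σ ^ 3)) →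 ∀ (T : ℝ) (ρ θ : ℝ → T3 → ℝ) (u : ℝ → T3 → V3), IsHardSphereEulerSolution σ T ρ u θ → (∃ (ubar : V3) (θbar : ℝ), ∀ x, |ρ 0 x - 1| ≤ δ₀ ∧ ‖u 0 x - ubar‖ ≤ δ₀ ∧ |θ 0 x - θbar| ≤ δ₀) → ∀ Φ : (N : ℕ) → HardSphereFlow (Torus.geometry (Fin 3)) (ε N) (n N), let P : (N : ℕ) → Measure (Config (n N) (Fin 3) T3) := fun N => particleLaw (Φ N) (canonicalDensity (Torus.geometry (Fin 3)) (ε N) (n N) (localGibbsProfile a₀ u₀ θ₀)); (∀ N, IsProbabilityMeasure (P N)) → (∀ χ : T3 → ℝ, Continuous χ → ∀ δ : ℝ, 0 < δ → Tendsto (fun N => P N {z | δ < |empiricalDensityField ((Φ N).flow 0 z) χ - ∫ x, χ x * ρ 0 x|}) atTop (nhds 0) ∧ Tendsto (fun N => P N {z | δ < ‖empiricalMomentumField ((Φ N).flow 0 z) χ - ∫ x, (χ x * ρ 0 x) • u 0 x‖}) atTop (nhds 0) ∧ Tendsto (fun N => P N {z | δ < |empiricalEnergyField ((Φ N).flow 0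 z) χ - ∫ x, χ x * totalEnergyDensity (ρ 0 x) (u 0 x) (θ 0 x)|}) atTop (nhds 0)) → ∀ L : ℝ, M ≤ L → ∀ t ∈ Set.Ico 0 (min T (s₀ / L)), (∀ s ∈ Set.Icc 0 t, ∀ x, ρ s x * σ ^ 3 < η₀ ∧ θ s x ≤ M ∧ M⁻¹ ≤ θ s x ∧ ‖u s x‖ ≤ M ∧ ∀ i : Fin 3, |Torus.partialDeriv i (ρ s) x| ≤ L ∧ ‖Torus.partialDeriv i (u s) x‖ ≤ L ∧ |Torus.partialDeriv i (θ s) x| ≤ L) → ∀ χ : T3 → ℝ, Continuous χ → ∀ δ : ℝ, 0 < δ → Tendsto (fun N => P N {z | δ < |empiricalDensityField ((Φ N).flow t z) χ - ∫ x, χ x * ρ t x|}) atTop (nhds 0) ∧ Tendsto (fun N => P N {z | δ < ‖empiricalMomentumField ((Φ N).flow t z) χ - ∫ x, (χ x * ρ t x) • u t x‖}) atTop (nhds 0) ∧ Tendsto (fun N => P N {z | δ < |empiricalEnergyField ((Φ N).flow t z) χ - ∫ x, χ x * totalEnergyDensity (ρ t x) (u t x) (θ t x)|}) atTop (nhds 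0)

/-- Relative `C⁰` nearness, on the ball of radius `R` about `x₀`, of the datum `(ρ, u, θ)` to the ISOTHERMAL
ATMOSPHERE fitted at `x₀` with log-density slope `g`: `|log ρ(x) − log ρ(x₀) − ⟪g, x − x₀⟫| ≤ δ`,
`‖u(x) − u(x₀)‖ ≤ δ`, `|θ(x)/θ(x₀) − 1| ≤ δ` (minimal-image chart `Torus.reprSym`, valid for `R < 1/2`). -/
@[folklore] def NearAtmosphereOn (ρ θ : T3 → ℝ) (u : T3 → V3) (x₀ : T3) (g : V3) (R δ : ℝ) : Prop :=
  ∀ x, Torus.euclidDist x x₀ < R →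
    |Real.log (ρ x) - Real.log (ρ x₀) - inner ℝ g (Torus.reprSym (x - x₀))| ≤ δ ∧
    ‖u x - u x₀‖ ≤ δ ∧ |θ x / θ x₀ - 1| ≤ δ

/-- **Foreign stub 2 — `NearAtmosphereHL`, the fielded twin of `B` through the Einstein elevator** (local form, for
the conjunct's own family, so no comparison gas is needed): for every level `M` and natural horizon `Θ` there are a
number of scale heights `K`, a nearness `δ > 0` and a minimal steepness `G₀` such that: whenever the time-`0` Euler
datum tied to the local Gibbs data is `δ`-near, on the ball of `K` scale heights `B(x₀, K/‖g‖)`, to the isothermal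
atmosphere of log-density slope `g` (`‖g‖ ≥ G₀`), and the level-`M` guards of `S` hold on `[0, t]`,
`t < Θ/‖g‖`, then the three-field LLN holds at time `t` for every test function supported in the unit scale-height
ball `B(x₀, 1/‖g‖)`. At `δ = 0` the datum is an exact free-falling atmosphere = the elevator image
`(x, v) ↦ (x + ½ a t², v + a t)`, `a = θ(x₀) g`, of the barometric Gibbs state, INVARIANT under the uniformly forced
hard-sphere flow: equilibrium statistical mechanics + a fielded equilibrium light cone, no hydrodynamic modes. -/
@[conjecture] def NearAtmosphereHL : Prop :=
  ∃ η₀ : ℝ, 0 < η₀ ∧ ∀ M : ℝ, 0 < M → ∀ Θ : ℝ, 0 < Θ → ∃ K : ℝ, 1 ≤ K ∧ ∃ δ : ℝ, 0 < δ ∧ ∃ G₀ : ℝ, 4 * K ≤ G₀ ∧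
    ∀ (a₀ θ₀ : T3 → ℝ) (u₀ : T3 → V3), Continuous a₀ → Continuous θ₀ → Continuous u₀ → (∀ x, 0 < a₀ x) → (∀ x, 0 < θ₀ x) →
    ∃ σ₀ : ℝ, 0 < σ₀ ∧ ∀ σ : ℝ, 0 < σ → σ < σ₀ →
    ∀ (T : ℝ) (ρ θ : ℝ → T3 → ℝ) (u : ℝ → T3 → V3), IsHardSphereEulerSolution σ T ρ u θ →
    ∀ Φ : (N : ℕ) → HardSphereFlow (Torus.geometry (Fin 3)) (hsDiameter σ N) (N + 1),
    TendstoHydroFieldsAt (fun N => localGibbsLaw σ a₀ u₀ θ₀ N (Φ N)) Φ ρ u θ 0 →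
    ∀ (x₀ : T3) (g : V3), G₀ ≤ ‖g‖ →
    NearAtmosphereOn (ρ 0) (θ 0) (u 0) x₀ g (K / ‖g‖) δ →
    ∀ t ∈ Set.Ico 0 (min T (Θ / ‖g‖)), (∀ s ∈ Set.Icc 0 t, ∀ x, GuardAt η₀ M σ ρ θ u s x) →
    ∀ χ : T3 → ℝ, Continuous χ → (∀ x, 1 / ‖g‖ ≤ Torus.euclidDist x x₀ → χ x = 0) → ∀ δ' : ℝ, 0 < δ' →
      Tendsto (fun N => localGibbsLaw σ a₀ u₀ θ₀ N (Φ N) {z | δ' < |empiricalDensityField ((Φ N).flow t z) χ - ∫ x, χ x * ρ t x|}) atTop (nhds 0) ∧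
      Tendsto (fun N => localGibbsLaw σ a₀ u₀ θ₀ N (Φ N) {z | δ' < ‖empiricalMomentumField ((Φ N).flow t z) χ - ∫ x, (χ x * ρ t x) • u t x‖}) atTop (nhds 0) ∧
      Tendsto (fun N => localGibbsLaw σ a₀ u₀ θ₀ N (Φ N) {z | δ' < |empiricalEnergyField ((Φ N).flow t z) χ - ∫ x, χ x * totalEnergyDensity (ρ t x) (u t x) (θ t x)|}) atTop (nhds 0)



/-- Scale-covariant guards at scale `ℓ` (the image of `GuardAt` under the hyperbolic zoom `x ↦ x/ℓ`, `t ↦ t/ℓ`, which leaves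
`ρ, u, θ` invariant and multiplies `k`-th derivatives by `ℓᵏ`): sizes at level `M`, `k`-th derivatives bounded by `M/ℓᵏ`.
For `ℓ = 1` it is `GuardAt`; for `ℓ ≤ 1` it is WEAKER than `GuardAt` (so the conjunct's own guarded solutions qualify at every
scale), and it is what the unit-density-normalised comparison gases of the line satisfy at their flattening scale. -/
@[folklore] def GuardAtScale (η M ℓ σ : ℝ) (ρ θ : ℝ → T3 → ℝ) (u : ℝ → T3 → V3) (s : ℝ) (x : T3) : Prop :=
  ρ s x * σ ^ 3 < η ∧ ρ s x ≤ M ∧ θ s x ≤ M ∧ M⁻¹ ≤ θ s x ∧ ‖u s x‖ ≤ M ∧ ∀ i j k : Fin 3,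
    |Torus.partialDeriv i (ρ s) x| ≤ M / ℓ ∧ ‖Torus.partialDeriv i (u s) x‖ ≤ M / ℓ ∧ |Torus.partialDeriv i (θ s) x| ≤ M / ℓ ∧
    |Torus.partialDeriv i (Torus.partialDeriv j (ρ s)) x| ≤ M / ℓ ^ 2 ∧
    ‖Torus.partialDeriv i (Torus.partialDeriv j (u s)) x‖ ≤ M / ℓ ^ 2 ∧
    |Torus.partialDeriv i (Torus.partialDeriv j (θ s)) x| ≤ M / ℓ ^ 2 ∧
    |Torus.partialDeriv i (Torus.partialDeriv j (Torus.partialDeriv k (ρ s))) x| ≤ M / ℓ ^ 3 ∧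
    ‖Torus.partialDeriv i (Torus.partialDeriv j (Torus.partialDeriv k (u s))) x‖ ≤ M / ℓ ^ 3 ∧
    |Torus.partialDeriv i (Torus.partialDeriv j (Torus.partialDeriv k (θ s))) x| ≤ M / ℓ ^ 3

/-- **The single foreign input, unified and GLOBAL (route-faithful form: `LightConeInLaw` still does the localisation).**
`ElevatorOrbitHL`: near-equilibrium hydrodynamic limit around the ELEVATOR ORBIT {constants} ∪ {free-falling isothermal
atmospheres}, hyperbolic-scaling covariant. For every level `M` and natural horizon `Θ` there are `K ≥ 1` and `δ > 0` such
that for general diameter/number families (as in `NearConstantShortTimeHL`): if at ONE admissible scale `ℓ₀` the time-`0`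
datum is, around EVERY point, `δ`-near some atmosphere of slope `‖g‖ ≤ 1/ℓ₀` (slope `0` = near-constant) on the ball of
radius `K ℓ₀`, then the LLN at `0` propagates to every `t < Θ ℓ₀` at which the level-`M` guards AT SCALE `ℓ₀` (`GuardAtScale`: `k`-th derivatives `≤ M/ℓ₀ᵏ`) hold on `[0, t]` — the hyperbolic-zoom image of a fixed-scale statement. Face
`g = 0`: the scale-covariant `B` (whose `ℓ₀ = 1/(4K)` instance is the content of `NearConstantShortTimeHL` up to constants and guard lists — `B` asks `C¹` guards only). Face `g ≠ 0`: `B`'s fielded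
twin; at `δ = 0` pure equilibrium statistical mechanics through the elevator. -/
@[conjecture] def ElevatorOrbitHL : Prop :=
  ∃ η₀ : ℝ, 0 < η₀ ∧ ∀ M : ℝ, 0 < M → ∀ Θ : ℝ, 0 < Θ → ∃ K : ℝ, 1 ≤ K ∧ ∃ δ : ℝ, 0 < δ ∧
    ∀ (a₀ θ₀ : T3 → ℝ) (u₀ : T3 → V3), Continuous a₀ → Continuous θ₀ → Continuous u₀ → (∀ x, 0 < a₀ x) → (∀ x, 0 < θ₀ x) →
    ∃ σ₀ : ℝ, 0 < σ₀ ∧ ∀ σ : ℝ, 0 < σ → σ < σ₀ →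
    ∀ (ε : ℕ → ℝ) (n : ℕ → ℕ), (∀ N, 0 < ε N) → Tendsto ε atTop (nhds 0) → Tendsto (fun N => (n N : ℝ) * ε N ^ 3) atTop (nhds (σ ^ 3)) →
    ∀ (T : ℝ) (ρ θ : ℝ → T3 → ℝ) (u : ℝ → T3 → V3), IsHardSphereEulerSolution σ T ρ u θ →
    ∀ ℓ₀ : ℝ, 0 < ℓ₀ → K * ℓ₀ ≤ 1 / 4 →
    (∀ x₀ : T3, ∃ g : V3, ‖g‖ * ℓ₀ ≤ 1 ∧ NearAtmosphereOn (ρ 0) (θ 0) (u 0) x₀ g (K * ℓ₀) δ) →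
    ∀ Φ : (N : ℕ) → HardSphereFlow (Torus.geometry (Fin 3)) (ε N) (n N),
    let P : (N : ℕ) → Measure (Config (n N) (Fin 3) T3) := fun N =>
      particleLaw (Φ N) (canonicalDensity (Torus.geometry (Fin 3)) (ε N) (n N) (localGibbsProfile a₀ u₀ θ₀))
    (∀ N, IsProbabilityMeasure (P N)) →
    (∀ χ : T3 → ℝ, Continuous χ → ∀ δ' : ℝ, 0 < δ' →
      Tendsto (fun N => P N {z | δ' < |empiricalDensityField ((Φ N).flow 0 z) χ - ∫ x, χ x * ρ 0 x|}) atTop (nhds 0) ∧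
      Tendsto (fun N => P N {z | δ' < ‖empiricalMomentumField ((Φ N).flow 0 z) χ - ∫ x, (χ x * ρ 0 x) • u 0 x‖}) atTop (nhds 0) ∧
      Tendsto (fun N => P N {z | δ' < |empiricalEnergyField ((Φ N).flow 0 z) χ - ∫ x, χ x * totalEnergyDensity (ρ 0 x) (u 0 x) (θ 0 x)|}) atTop (nhds 0)) →
    ∀ t ∈ Set.Ico 0 (min T (Θ * ℓ₀)), (∀ s ∈ Set.Icc 0 t, ∀ x, GuardAtScale η₀ M ℓ₀ σ ρ θ u s x) →
    ∀ χ : T3 → ℝ, Continuous χ → ∀ δ' : ℝ, 0 < δ' →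
      Tendsto (fun N => P N {z | δ' < |empiricalDensityField ((Φ N).flow t z) χ - ∫ x, χ x * ρ t x|}) atTop (nhds 0) ∧
      Tendsto (fun N => P N {z | δ' < ‖empiricalMomentumField ((Φ N).flow t z) χ - ∫ x, (χ x * ρ t x) • u t x‖}) atTop (nhds 0) ∧
      Tendsto (fun N => P N {z | δ' < |empiricalEnergyField ((Φ N).flow t z) χ - ∫ x, χ x * totalEnergyDensity (ρ t x) (u t x) (θ t x)|}) atTop (nhds 0)

/-- **The elevator itself (deterministic, exact, every `N`)**: the Galilean free-fall map conjugates the free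
hard-sphere flow on `𝕋³` to the flow under the uniform force `a`. Stated here only at the level of configurations as
the map; the conjugacy is the content of the line's `stub_elevator` (it needs a forced `HardSphereFlow`, not yet an
object of the tree). -/
def elevator {N : ℕ} (a : V3) (t : ℝ) (z : Config N (Fin 3) T3) : Config N (Fin 3) T3 :=
  fun i => ((z i).1 + Torus.proj ((t ^ 2 / 2) • a), (z i).2 + t • a)

/-- Shape of the intended composition (the line for crux-plan; `FlatCover`/`SteepCover` are the two glue stubs that
consume `A = LightConeInLaw`, `B` via `ScaleCovariantNearConstantHL`, and the first lemma). Recorded as a `Prop`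
schema only. -/
def LineShape (FlatCover SteepCover : Prop) : Prop :=
  DynamicLogLipschitz → ElevatorOrbitHL → FlatCover → SteepCover → ConeLocalisation

end Summit.AtomisticToContinuum.HydrodynamicLimit.Cruxes.ConeLocalisation.EinsteinElevator

end
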